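import Summits.ResolutionOfSingularities.ResolutionOfSingularities.Theorems.PurelyInseparableDim4IsoSpine
import HarnessLib
import HarnessLib.Audit.Tags

/-!
# Purely inseparable four-folds — ISO-SPINE-PO, part II: THEOREM T(n,q)
# (no infinite point-only branch of chart-origin point blow-ups, every `n`, every `q`)
# [OURS · counted 0 · cell res-dim4-pi · idea-3's card I-3-4 (statement, paper proof) · p-9 (Lean)]

Sequel of `PurelyInseparableDim4IsoSpine.lean` (statements verbatim from res-dim4-idea-3's
`IsoSpineSketch.lean`; the frozen-monomial lemma).  Here: `IsoSpine.noPointOnlySpineBranch :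
∀ n q, NoPointOnlySpineBranch n q` — there is no infinite sequence of legal, POINT-ONLY supports
`A₀, A₁, …` with `A_{t+1} ⊆ σ_{j_t}(A_t)` (chart-origin exponent law, arbitrary deletions).  Proof
(memo ISO-SPINE-PO §3, reorganised for the kernel):

* §1 one move on one monomial: FAR monomials (every off-axis degree `≥ q`) stay far
  (`far_spineMove`), so near ones come from near ones; for a NEAR monomial the largest exponent
  `π = sup m` does not increase (`sup_spineMove_le`) and the degree is `< π + q` (`sum_lt_sup_add`).
* §2 reductions of a branch: keep only the near monomials (`nearBranch` — still a branch, point-only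
  witnesses are near); the cardinalities `|A_t|` are non-increasing (the move is injective on legal
  monomials), hence eventually constant (`exists_eventually_const_of_succ_le`), after which NO
  deletion happens: `A_{t+1} = σ_{j_t}(A_t)` exactly (`eq_image_of_card_eq`).
* §3 the theorem: from that time `T` on every monomial of `A_{T+k}` is the `k`-th point of the orbit
  of a monomial of `A_T` (`eq_image_orbit`); each orbit is near for ever, so of bounded degree
  (`< π(m) + q`), so FROZEN from some time on (part I); after the latest freezing time the point-only
  witness at the played axis is a near monomial that the move must fix AND strictly lower in degree —
  contradiction.

Degenerate cases need no hypothesis: for `n = 0` there is no chart to play (`Fin 0` is empty), for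
`q = 0` no support is point-only.  Nothing here is a statement about resolution of singularities;
resolution in dimension ≥ 4 / characteristic `p` is NOT proved anywhere in this programme; counted 0;
AI formalisation, weaker than expert review.  bears_on: LADDER-RESOLUTION:D157-DOOR2 (res-dim4-pi ·
ISO-SPINE-PO). Supports stmt-ResolutionOfSingularities-16155 (helper).
-/

set_option linter.dupNamespace false

namespace Summit.ResolutionOfSingularities.ResolutionOfSingularities.Theorems.PIDim4.IsoSpine

open Finset

/-! ## 1. One move on one monomial: far stays far, `π` does not grow on near monomials -/

/-- **Far stays far**: if every off-axis degree of a legal `m` is `≥ q`, the same holds after any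
chart-origin move. [folklore] -/
theorem far_spineMove {n : ℕ} (q : ℕ) (j : Fin n) (m : Fin n → ℕ) (hq : q ≤ ∑ i, m i)
    (hfar : ∀ k, q ≤ (∑ i, m i) - m k) : ∀ k, q ≤ (∑ i, spineMove q j m i) - spineMove q j m k := by
  intro k
  have hadd := sum_spineMove_add q j m hq
  have hj := hfar j
  by_cases hkj : k = j
  · subst hkj
    rw [sum_spineMove_sub_self q k m hq]
    exact hj
  · rw [spineMove_apply_of_ne q hkj]
    have hk := hfar k
    have hmk := apply_le_sum m k
    omega

/-- Hence a NEAR monomial after the move (some off-axis degree `< q`) was near before. [folklore] -/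
theorem near_of_near_spineMove {n : ℕ} (q : ℕ) (j : Fin n) (m : Fin n → ℕ) (hq : q ≤ ∑ i, m i)
    (hnear : ∃ k, (∑ i, spineMove q j m i) - spineMove q j m k < q) :
    ∃ k, (∑ i, m i) - m k < q := by
  by_contra h
  push Not at h
  obtain ⟨k, hk⟩ := hnear
  exact absurd (far_spineMove q j m hq h k) (not_le.mpr hk)

/-- A coordinate is at most the largest exponent `π = sup m`. [folklore] -/
theorem apply_le_sup {n : ℕ} (m : Fin n → ℕ) (k : Fin n) : m k ≤ Finset.univ.sup m :=
  Finset.le_sup (f := m) (Finset.mem_univ k)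

/-- A NEAR monomial has degree `< π + q`. [folklore] -/
theorem sum_lt_sup_add {n : ℕ} (q : ℕ) (m : Fin n → ℕ) (hnear : ∃ k, (∑ i, m i) - m k < q) :
    ∑ i, m i < Finset.univ.sup m + q := by
  obtain ⟨k, hk⟩ := hnear
  have h1 := apply_le_sup m k
  have h2 := apply_le_sum m k
  omega

/-- **`π` does not grow along near monomials**: for a legal near `m`, `sup (spineMove q j m) ≤ sup m`
(the new `j`-exponent `|m| − q` is `< π`). [folklore] -/
theorem sup_spineMove_le {n : ℕ} (q : ℕ) (j : Fin n) (m : Fin n → ℕ) (hq : q ≤ ∑ i, m i)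
    (hnear : ∃ k, (∑ i, m i) - m k < q) :
    Finset.univ.sup (spineMove q j m) ≤ Finset.univ.sup m := by
  refine Finset.sup_le fun i _ => ?_
  by_cases hij : i = j
  · subst hij
    rw [spineMove_apply_self]
    have h := sum_lt_sup_add q m hnear
    omega
  · rw [spineMove_apply_of_ne q hij]
    exact apply_le_sup m i

/-! ## 2. Reductions of a branch -/

/-- **The near sub-branch**: keeping at every time only the near monomials of a legal point-only
branch gives a legal point-only branch (the point-only witnesses are near, and a near monomial comes
from a near one). [folklore] -/
theorem nearBranch {n : ℕ} (q : ℕ) (A : ℕ → Finset (Fin n → ℕ)) (j : ℕ → Fin n)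
    (h : ∀ t, Legal q (A t) ∧ PointOnly q (A t) ∧ A (t + 1) ⊆ (A t).image (spineMove q (j t))) :
    ∀ t, Legal q ((A t).filter fun m => ∃ k, (∑ i, m i) - m k < q) ∧
      PointOnly q ((A t).filter fun m => ∃ k, (∑ i, m i) - m k < q) ∧
      ((A (t + 1)).filter fun m => ∃ k, (∑ i, m i) - m k < q) ⊆
        ((A t).filter fun m => ∃ k, (∑ i, m i) - m k < q).image (spineMove q (j t)) := by
  intro t
  obtain ⟨hL, hP, hS⟩ := h t
  refine ⟨fun m hm => hL m (Finset.mem_filter.mp hm).1, fun k => ?_, fun x hx => ?_⟩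
  · obtain ⟨m, hm, hmk⟩ := hP k
    exact ⟨m, Finset.mem_filter.mpr ⟨hm, k, hmk⟩, hmk⟩
  · obtain ⟨hxA, hxnear⟩ := Finset.mem_filter.mp hx
    obtain ⟨y, hy, rfl⟩ := Finset.mem_image.mp (hS hxA)
    exact Finset.mem_image.mpr
      ⟨y, Finset.mem_filter.mpr ⟨hy, near_of_near_spineMove q (j t) y (hL y hy) hxnear⟩, rfl⟩

/-- Along a legal branch the cardinalities do not increase (the move is injective on legal
monomials). [folklore] -/
theorem card_succ_le {n : ℕ} (q : ℕ) (A : ℕ → Finset (Fin n → ℕ)) (j : ℕ → Fin n)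
    (hL : ∀ t, Legal q (A t)) (hS : ∀ t, A (t + 1) ⊆ (A t).image (spineMove q (j t))) (t : ℕ) :
    (A (t + 1)).card ≤ (A t).card := by
  refine le_trans (Finset.card_le_card (hS t)) ?_
  rw [Finset.card_image_of_injOn]
  intro x hx y hy hxy
  exact spineMove_injective_of_legal q (j t) (hL t x hx) (hL t y hy) hxy

/-- A non-increasing sequence of naturals is eventually constant. [folklore] -/
theorem exists_eventually_const_of_succ_le (c : ℕ → ℕ) (hc : ∀ t, c (t + 1) ≤ c t) :
    ∃ T, ∀ t, T ≤ t → c t = c T := by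
  have hanti : ∀ s t, s ≤ t → c t ≤ c s := fun s t hst => antitone_nat_of_succ_le hc hst
  suffices key : ∀ k (c : ℕ → ℕ), (∀ s t, s ≤ t → c t ≤ c s) → c 0 ≤ k →
      ∃ T, ∀ t, T ≤ t → c t = c T from key (c 0) c hanti le_rfl
  intro k
  induction k with
  | zero =>
    intro c hanti h0
    exact ⟨0, fun t _ => by have := hanti 0 t (Nat.zero_le t); omega⟩
  | succ k ih =>
    intro c hanti h0
    by_cases hall : ∀ t, c t = c 0
    · exact ⟨0, fun t _ => hall t⟩
    · push Not at hall
      obtain ⟨t₀, ht₀⟩ := hall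
      have hlt : c t₀ < c 0 := lt_of_le_of_ne (hanti 0 t₀ (Nat.zero_le _)) ht₀
      obtain ⟨T, hT⟩ := ih (fun t => c (t + t₀))
        (fun s t hst => hanti (s + t₀) (t + t₀) (by omega)) (by show c (0 + t₀) ≤ k; rw [zero_add]; omega)
      refine ⟨T + t₀, fun t ht => ?_⟩
      have h := hT (t - t₀) (by omega)
      have ht' : t - t₀ + t₀ = t := Nat.sub_add_cancel (by omega)
      rw [ht'] at h
      exact h

/-- **No deletions once the cardinality is constant**: then `A_{t+1} = σ_{j_t}(A_t)` exactly.
[folklore] -/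
theorem eq_image_of_card_eq {n : ℕ} (q : ℕ) (A : ℕ → Finset (Fin n → ℕ)) (j : ℕ → Fin n)
    (hL : ∀ t, Legal q (A t)) (hS : ∀ t, A (t + 1) ⊆ (A t).image (spineMove q (j t)))
    {T : ℕ} (hT : ∀ t, T ≤ t → (A t).card = (A T).card) (t : ℕ) (ht : T ≤ t) :
    A (t + 1) = (A t).image (spineMove q (j t)) := by
  refine Finset.eq_of_subset_of_card_le (hS t) ?_
  rw [Finset.card_image_of_injOn (fun x hx y hy hxy =>
    spineMove_injective_of_legal q (j t) (hL t x hx) (hL t y hy) hxy), hT t ht, hT (t + 1) (by omega)]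

/-! ## 3. Theorem T(n,q) -/

/-- **Orbits carry the branch** once there are no deletions: `A_{T+k}` is the image of `A_T` under
the `k`-step orbit map `m ↦ σ_{j_{T+k-1}} ⋯ σ_{j_T} m`. [folklore] -/
theorem eq_image_orbit {n : ℕ} (q : ℕ) (A : ℕ → Finset (Fin n → ℕ)) (j : ℕ → Fin n) (T : ℕ)
    (hstep : ∀ k, A (T + k + 1) = (A (T + k)).image (spineMove q (j (T + k)))) (k : ℕ) :
    A (T + k) = (A T).image fun m =>
      Nat.rec (motive := fun _ => Fin n → ℕ) m (fun i x => spineMove q (j (T + i)) x) k := by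
  induction k with
  | zero =>
    ext x
    simp only [Nat.add_zero, Finset.mem_image]
    exact ⟨fun hx => ⟨x, hx, rfl⟩, fun ⟨y, hy, hyx⟩ => hyx ▸ hy⟩
  | succ k ih =>
    rw [← Nat.add_assoc, hstep k, ih, Finset.image_image]
    rfl

/-- **THEOREM T(n,q) — ISO-SPINE-PO** (res-dim4-idea-3, memo §3; every `n`, every `q`): there is no
infinite legal point-only spine branch.  Census reading: an infinite branch of ISOLATED `q`-fold
points of `z^q + F` cannot consist of chart-origin point blow-ups only — it must contain infinitely
many translated edges (frame corollary in `PurelyInseparableDim4IsoSpineFrame.lean`). [folklore] -/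
theorem noPointOnlySpineBranch (n q : ℕ) : NoPointOnlySpineBranch n q := by
  classical
  rintro ⟨A₀, j, h₀⟩
  -- §2 (i): pass to the near sub-branch
  set A : ℕ → Finset (Fin n → ℕ) := fun t => (A₀ t).filter fun m => ∃ k, (∑ i, m i) - m k < q
    with hA
  have h : ∀ t, Legal q (A t) ∧ PointOnly q (A t) ∧ A (t + 1) ⊆ (A t).image (spineMove q (j t)) :=
    nearBranch q A₀ j h₀
  have hnear : ∀ t, ∀ m ∈ A t, ∃ k, (∑ i, m i) - m k < q := fun t m hm =>
    (Finset.mem_filter.mp hm).2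
  have hL : ∀ t, Legal q (A t) := fun t => (h t).1
  have hP : ∀ t, PointOnly q (A t) := fun t => (h t).2.1
  have hS : ∀ t, A (t + 1) ⊆ (A t).image (spineMove q (j t)) := fun t => (h t).2.2
  -- §2 (ii): the cardinality stabilises at some time `T`; no deletions afterwards
  obtain ⟨T, hT⟩ := exists_eventually_const_of_succ_le (fun t => (A t).card) (card_succ_le q A j hL hS)
  have hstep : ∀ k, A (T + k + 1) = (A (T + k)).image (spineMove q (j (T + k))) := fun k =>
    eq_image_of_card_eq q A j hL hS hT (T + k) (Nat.le_add_right T k)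
  -- §3: orbits of the monomials of `A T`
  have horb := eq_image_orbit q A j T hstep
  -- each orbit is near for ever, `π` does not grow, the degree stays `< π(m) + q`: FROZEN
  have hfreeze : ∀ m, ∃ tm : ℕ, m ∈ A T → ∀ k, tm ≤ k →
      Nat.rec (motive := fun _ => Fin n → ℕ) m (fun i x => spineMove q (j (T + i)) x) (k + 1) =
        Nat.rec (motive := fun _ => Fin n → ℕ) m (fun i x => spineMove q (j (T + i)) x) k := by
    intro m
    by_cases hm : m ∈ A T
    · -- the orbit as a sequence
      set g : ℕ → (Fin n → ℕ) := fun k =>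
        Nat.rec (motive := fun _ => Fin n → ℕ) m (fun i x => spineMove q (j (T + i)) x) k with hg
      have hg0 : g 0 = m := rfl
      have hgs : ∀ k, g (k + 1) = spineMove q (j (T + k)) (g k) := fun k => rfl
      have hmem : ∀ k, g k ∈ A (T + k) := fun k => by
        rw [horb k]
        exact Finset.mem_image_of_mem _ hm
      have hleg : ∀ k, q ≤ ∑ i, g k i := fun k => hL (T + k) (g k) (hmem k)
      have hsup : ∀ k, Finset.univ.sup (g k) ≤ Finset.univ.sup m := by
        intro k
        induction k with
        | zero => exact le_rfl
        | succ k ih =>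
          rw [hgs k]
          exact le_trans (sup_spineMove_le q _ (g k) (hleg k) (hnear _ _ (hmem k))) ih
      have hbd : ∀ k, ∑ i, g k i ≤ Finset.univ.sup m + q := fun k =>
        le_trans (le_of_lt (sum_lt_sup_add q (g k) (hnear _ _ (hmem k))))
          (Nat.add_le_add_right (hsup k) q)
      obtain ⟨t₁, ht₁⟩ := frozenMonomialLemma n q (fun k => j (T + k)) g (Finset.univ.sup m + q)
        hgs hleg hbd
      exact ⟨t₁, fun _ k hk => ht₁ k hk⟩
    · exact ⟨0, fun h' => (hm h').elim⟩
  choose tf htf using hfreeze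
  -- the latest freezing time over the (finitely many) monomials of `A T`
  set t₁ := (A T).sup tf with ht₁
  -- the point-only witness at the axis played at time `T + t₁`
  obtain ⟨x, hx, hxnear⟩ := hP (T + t₁) (j (T + t₁))
  rw [horb t₁] at hx
  obtain ⟨m, hm, rfl⟩ := Finset.mem_image.mp hx
  have hfix := htf m hm t₁ (Finset.le_sup (f := tf) hm)
  -- the frozen orbit is fixed by the move, but a near witness strictly loses degree
  have hq : q ≤ ∑ i, (Nat.rec (motive := fun _ => Fin n → ℕ) m
      (fun i x => spineMove q (j (T + i)) x) t₁) i := by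
    refine hL (T + t₁) _ ?_
    rw [horb t₁]
    exact Finset.mem_image_of_mem _ hm
  have hlt := sum_spineMove_lt_of_near q (j (T + t₁)) _ hq hxnear
  have heq := congrArg (fun y : Fin n → ℕ => ∑ i, y i) hfix
  simp only at heq
  change (∑ i, spineMove q (j (T + t₁)) _ i) = _ at heq
  omega

end Summit.ResolutionOfSingularities.ResolutionOfSingularities.Theorems.PIDim4.IsoSpine
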